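import Literature.Probability.RandomPlanarGeometry.CurveTortuosity
import Literature.Analysis.Complex.BoundaryUniqueness
import Mathlib.Analysis.Real.Pi.Bounds
import HarnessLib

/-!
# Pinching of multiple shell traversals on the middle circle; circle nets

Topic `Literature/Probability/RandomPlanarGeometry` (companion to `CurveTortuosity.lean`, whose
`Curve.HasTraversals k x r R` — "`D(x; r, R)` is traversed by `k` separate segments of the curve",
Aizenman–Burchard 1999, §1.b (1.3) — is the notion used throughout).  Deterministic plane
geometry behind the reduction of Aizenman–Burchard-type traversal bounds with a LARGE threshold
`k` on one shell to a FIXED threshold (`4`) on small shells centred on the middle circle: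

* `Curve.exists_pinch_of_hasTraversals` — **pigeonhole on the middle circle**: if a planar curve
  makes `k ≥ 2` separate traversals of `D(x; ρ₁, R₁)`, each traversal passes the middle circle
  `|z - x| = r`, `r = (ρ₁ + R₁)/2` (intermediate value theorem), two of the `k` passage points are
  within `4πr/k` of each other (pigeonhole in `k - 1` boxes of the argument, chord ≤ arc), and
  then the curve makes FOUR separate traversals of the small shell `D(y; 4πr/k, (R₁ - ρ₁)/2)`
  about one of them (`y`): in, out, in, out along the two pinching strands;
* `exists_lt_dist_lt_of_mem_sphere` — the pigeonhole step for `k` points of a circle;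
* `exists_dist_circleNet_le` — every point of the circle of radius `m` about `x` is within
  `2πm/k` of one of the `k` net points `x + m e^{i(-π + 2πj/k)}`, `j < k` (chord ≤ arc);
* `exists_good_mid` — of the three middle radii of the thirds of a shell `ρ < R`, one is at
  distance `≥ (R - ρ)/12` from two given numbers (the distances of two marked points from the
  centre), so that pinch centres on that circle stay `(R - ρ)/12` away from the marked points.

Folklore (elementary); the pinch device is the one-dimensional-net variant of AB99's covering
argument (§1.b, Lemma 3.1).  Mathlib anchors: `intermediate_value_Icc`, `Complex.arg_mem_Ioc`,
`Complex.norm_mul_exp_arg_mul_I`, `Finset.exists_ne_map_eq_of_card_lt_of_maps_to`; tree anchor: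
`Literature.Analysis.Complex.norm_exp_mul_I_sub_exp_mul_I_le` (chord ≤ arc,
`BoundaryUniqueness.lean`).

## References
* M. Aizenman, A. Burchard, *Hölder regularity and dimension bounds for random curves*, Duke
  Math. J. 99 (1999), §1.b (1.3), Lemma 3.1 [AizenmanBurchardDuke1999].
-/

noncomputable section

open _root_.Set _root_.Metric _root_.Complex _root_.Real
open scoped unitInterval

namespace Literature.Probability.RandomPlanarGeometry

/-! ### Passage through the middle circle, pigeonhole, the pinch -/

/-- Intermediate value on a traversal: the segment passes through the middle sphere at a time
strictly after its start. [folklore] -/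
theorem Curve.exists_mem_sphere_of_isTraversal {γ : Curve ℂ} {x : ℂ} {ρ₁ R₁ r : ℝ} {s t : I}
    (hρr : ρ₁ < r) (hrR : r < R₁) (h : γ.IsTraversal x ρ₁ R₁ s t) :
    ∃ m : I, s < m ∧ m ≤ t ∧ dist (γ m) x = r := by
  classical
  -- pull back to a continuous real function on `[s, t]`
  set g : ℝ → ℝ := fun u => dist (γ (Set.projIcc (0 : ℝ) 1 zero_le_one u)) x with hg
  have hgc : Continuous g := (γ.continuous.comp continuous_projIcc).dist continuous_const
  have hgs : g s = dist (γ s) x := by simp [hg, Set.projIcc_val]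
  have hgt : g t = dist (γ t) x := by simp [hg, Set.projIcc_val]
  have hst : (s : ℝ) ≤ t := h.1
  -- `r` lies between the endpoint values, in one order or the other
  have hmem : r ∈ g '' Set.Icc (s : ℝ) t := by
    rcases h.2 with ⟨hs, ht⟩ | ⟨hs, ht⟩
    · exact intermediate_value_Icc hst hgc.continuousOn ⟨by rw [hgs]; linarith, by rw [hgt]; linarith⟩
    · exact intermediate_value_Icc' hst hgc.continuousOn ⟨by rw [hgt]; linarith, by rw [hgs]; linarith⟩
  obtain ⟨c, ⟨hsc, hct⟩, hgc'⟩ := hmem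
  have hc01 : c ∈ Set.Icc (0 : ℝ) 1 := ⟨s.2.1.trans hsc, hct.trans t.2.2⟩
  refine ⟨⟨c, hc01⟩, ?_, ?_, ?_⟩
  · -- strict: at time `s` the distance is `≠ r`
    rcases eq_or_lt_of_le (show s ≤ (⟨c, hc01⟩ : I) from hsc) with heq | hlt
    · exfalso
      have : g c = dist (γ s) x := by rw [← hgs]; congr 1; exact congrArg Subtype.val heq.symm
      rcases h.2 with ⟨hs, -⟩ | ⟨hs, -⟩ <;> linarith
    · exact hlt
  · exact hct
  · have : g c = dist (γ ⟨c, hc01⟩) x := by simp [hg, Set.projIcc_of_mem _ hc01]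
    rw [← this, hgc']

/-- Endpoints of a traversal of `D(x; ρ₁, R₁)` are far from every point of the middle sphere. [folklore] -/
theorem le_dist_of_endpoint {q x y : ℂ} {ρ₁ R₁ : ℝ} (hy : dist y x = (ρ₁ + R₁) / 2)
    (hq : dist q x ≤ ρ₁ ∨ R₁ ≤ dist q x) : (R₁ - ρ₁) / 2 ≤ dist q y := by
  rcases hq with hq | hq
  · have := dist_triangle y q x
    rw [dist_comm y q] at this
    linarith
  · have := dist_triangle q y x
    linarith

/-- Pigeonhole on a circle: among `k ≥ 2` points of the sphere of radius `r > 0` about `x`, two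
(with ordered indices) are at distance `< 4πr/k`. [folklore] -/
theorem exists_lt_dist_lt_of_mem_sphere {k : ℕ} (hk : 2 ≤ k) {x : ℂ} {r : ℝ} (hr : 0 < r)
    (p : Fin k → ℂ) (hp : ∀ i, dist (p i) x = r) :
    ∃ i j : Fin k, i < j ∧ dist (p i) (p j) < 4 * π * r / k := by
  classical
  have hk1 : (0 : ℝ) < (k : ℝ) - 1 := by
    have : (2 : ℝ) ≤ k := by exact_mod_cast hk
    linarith
  set w : ℝ := 2 * π / ((k : ℝ) - 1) with hw
  have hwpos : 0 < w := div_pos (by positivity) hk1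
  set val : Fin k → ℝ := fun i => (arg (p i - x) + π) / w with hval
  have hval0 : ∀ i, 0 ≤ val i := fun i => by
    have := (arg_mem_Ioc (p i - x)).1
    exact div_nonneg (by linarith) hwpos.le
  have hvalk : ∀ i, val i ≤ (k : ℝ) - 1 := fun i => by
    have h2 := (arg_mem_Ioc (p i - x)).2
    rw [hval, div_le_iff₀ hwpos, hw]
    field_simp
    nlinarith [Real.pi_pos]
  set b : Fin k → ℕ := fun i => min ⌊val i⌋₊ (k - 2) with hb
  -- the boxes: `b i ≤ val i ≤ b i + 1`
  have hbox : ∀ i, (b i : ℝ) ≤ val i ∧ val i ≤ b i + 1 := by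
    intro i
    by_cases hle : ⌊val i⌋₊ ≤ k - 2
    · have hbi : b i = ⌊val i⌋₊ := by simp [hb, hle]
      rw [hbi]
      exact ⟨Nat.floor_le (hval0 i), (Nat.lt_floor_add_one (val i)).le⟩
    · have hbi : b i = k - 2 := by simp [hb, (not_le.1 hle).le]
      rw [hbi]
      refine ⟨?_, ?_⟩
      · have h1 : ((k - 2 : ℕ) : ℝ) ≤ (⌊val i⌋₊ : ℝ) := by exact_mod_cast (not_le.1 hle).le
        exact h1.trans (Nat.floor_le (hval0 i))
      · have h2 : ((k - 2 : ℕ) : ℝ) = (k : ℝ) - 2 := by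
          rw [Nat.cast_sub hk]; norm_num
        rw [h2]; linarith [hvalk i]
  -- pigeonhole: `b` maps `univ` (card k) into `range (k-1)`
  have hmaps : ∀ i ∈ (Finset.univ : Finset (Fin k)), b i ∈ Finset.range (k - 1) := by
    intro i _
    rw [Finset.mem_range]
    have : b i ≤ k - 2 := min_le_right _ _
    omega
  have hcard : (Finset.range (k - 1)).card < (Finset.univ : Finset (Fin k)).card := by
    simp; omega
  obtain ⟨i, -, j, -, hij, hbij⟩ := Finset.exists_ne_map_eq_of_card_lt_of_maps_to hcard hmaps
  -- equal boxes ⇒ angles within `w`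
  have hang : |arg (p i - x) - arg (p j - x)| ≤ w := by
    have h1 := hbox i; have h2 := hbox j
    rw [hbij] at h1
    have hv : |val i - val j| ≤ 1 := by rw [abs_le]; constructor <;> linarith [h1.1, h1.2, h2.1, h2.2]
    have : arg (p i - x) - arg (p j - x) = w * (val i - val j) := by
      simp only [hval]; field_simp; ring
    rw [this, abs_mul, abs_of_pos hwpos]
    calc w * |val i - val j| ≤ w * 1 := by gcongr
      _ = w := mul_one w
  -- chord ≤ arc
  have hpi : ∀ l, p l - x = (r : ℂ) * Complex.exp (arg (p l - x) * Complex.I) := fun l => by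
    have h := norm_mul_exp_arg_mul_I (p l - x)
    have hn : ‖p l - x‖ = r := by rw [← dist_eq_norm]; exact hp l
    rw [hn] at h
    exact h.symm
  have hdist : dist (p i) (p j) ≤ r * w := by
    rw [dist_eq_norm, show p i - p j = (p i - x) - (p j - x) by ring, hpi i, hpi j, ← mul_sub,
      norm_mul, Complex.norm_real, Real.norm_eq_abs, abs_of_pos hr]
    gcongr
    exact (norm_exp_mul_I_sub_exp_mul_I_le _ _).trans hang
  have hdist2 : dist (p i) (p j) ≤ 2 * r := by
    have := dist_triangle (p i) x (p j)
    rw [hp i, dist_comm x (p j), hp j] at this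
    linarith
  -- strictness: `min (r w, 2 r) < 4 π r / k`
  have hlt : dist (p i) (p j) < 4 * π * r / k := by
    have hkpos : (0 : ℝ) < k := by linarith
    rcases eq_or_lt_of_le hk with h2 | h3
    · -- k = 2
      subst h2
      rw [lt_div_iff₀ hkpos]
      push_cast
      nlinarith [Real.pi_gt_three, hdist2, hr]
    · -- k ≥ 3 : r w = 2 π r /(k-1) < 4 π r / k
      have h3' : (3 : ℝ) ≤ k := by exact_mod_cast h3
      refine hdist.trans_lt ?_
      rw [hw, lt_div_iff₀ hkpos]
      rw [show r * (2 * π / ((k : ℝ) - 1)) * k = (2 * π * r * k) / ((k : ℝ) - 1) by ring,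
        div_lt_iff₀ hk1]
      have hpr : 0 < π * r := mul_pos Real.pi_pos hr
      nlinarith [hpr, h3']
  rcases lt_or_gt_of_ne hij with h | h
  · exact ⟨i, j, h, hlt⟩
  · exact ⟨j, i, h, by rwa [dist_comm]⟩

/-- **Pigeonhole on the middle circle** (Aizenman–Burchard-type reduction to a fixed threshold): `k ≥ 2` separate traversals of
`D(x; ρ₁, R₁)` force four separate traversals of `D(y; 4πr/k, (R₁-ρ₁)/2)` for some `y` with
`|y - x| = r = (ρ₁ + R₁)/2`. [cite: AizenmanBurchardDuke1999, §1.b] -/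
theorem Curve.exists_pinch_of_hasTraversals {γ : Curve ℂ} {x : ℂ} {ρ₁ R₁ : ℝ} {k : ℕ}
    (hρ : 0 ≤ ρ₁) (hR : ρ₁ < R₁) (hk : 2 ≤ k) (h : γ.HasTraversals k x ρ₁ R₁) :
    ∃ y : ℂ, dist y x = (ρ₁ + R₁) / 2 ∧
      γ.HasTraversals 4 y (4 * Real.pi * ((ρ₁ + R₁) / 2) / k) ((R₁ - ρ₁) / 2) := by
  classical
  obtain ⟨s, t, hst, hsep⟩ := h
  set r : ℝ := (ρ₁ + R₁) / 2 with hr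
  set R'' : ℝ := (R₁ - ρ₁) / 2 with hR''
  set η : ℝ := 4 * Real.pi * r / k with hη
  have hρr : ρ₁ < r := by rw [hr]; linarith
  have hrR : r < R₁ := by rw [hr]; linarith
  have hrpos : 0 < r := by linarith
  -- passage times through the middle sphere
  have hm : ∀ i, ∃ m : I, s i < m ∧ m ≤ t i ∧ dist (γ m) x = r := fun i =>
    Curve.exists_mem_sphere_of_isTraversal hρr hrR (hst i)
  choose m hsm hmt hmr using hm
  -- two strands pinch
  obtain ⟨i₀, j₀, hij, hd⟩ :=
    exists_lt_dist_lt_of_mem_sphere hk hrpos (fun i => γ (m i)) hmr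
  have hηpos : 0 < η := by
    have hkpos : (0 : ℝ) < k := by have : (2:ℝ) ≤ k := by exact_mod_cast hk
                                   linarith
    rw [hη]; positivity
  set y : ℂ := γ (m i₀) with hy
  -- times just before the passages
  -- just before a time `m > s` the curve is close to `γ m` (continuity)
  have hnear : ∀ {s m : I}, s < m → ∀ {ε : ℝ}, 0 < ε →
      ∃ m' : I, s ≤ m' ∧ m' < m ∧ dist (γ m') (γ m) < ε := by
    intro s m hsm ε hε
    obtain ⟨δ, hδ, hδε⟩ := Metric.continuousAt_iff.1 (γ.continuous.continuousAt (x := m)) ε hε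
    have hsm' : (s : ℝ) < m := hsm
    set c : ℝ := max (s : ℝ) ((m : ℝ) - δ / 2) with hc
    have hcm : c < m := max_lt hsm' (by linarith)
    have hc01 : c ∈ Set.Icc (0 : ℝ) 1 := ⟨s.2.1.trans (le_max_left _ _), hcm.le.trans m.2.2⟩
    refine ⟨⟨c, hc01⟩, ?_, hcm, hδε ?_⟩
    · show (s : ℝ) ≤ c
      rw [hc]; exact le_max_left _ _
    rw [Subtype.dist_eq, Real.dist_eq, abs_sub_comm, abs_of_pos (by simpa using hcm)]
    have : (m : ℝ) - δ / 2 ≤ c := le_max_right _ _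
    show (m : ℝ) - c < δ
    linarith
  obtain ⟨m₁, hsm₁, hm₁m, hd₁⟩ := hnear (hsm i₀) hηpos
  obtain ⟨m₂, hsm₂, hm₂m, hd₂⟩ := hnear (hsm j₀) (sub_pos.2 hd)
  have hd₂' : dist (γ m₂) y ≤ η := by
    have := dist_triangle (γ m₂) (γ (m j₀)) y
    rw [hy] at this ⊢
    have hcomm : dist (γ (m j₀)) (γ (m i₀)) = dist (γ (m i₀)) (γ (m j₀)) := dist_comm _ _
    linarith
  -- far endpoints
  have hfar : ∀ i, R'' ≤ dist (γ (s i)) y ∧ R'' ≤ dist (γ (t i)) y := by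
    intro i
    have hyx : dist y x = (ρ₁ + R₁) / 2 := hmr i₀
    rcases (hst i).2 with ⟨hs, ht⟩ | ⟨hs, ht⟩
    · exact ⟨le_dist_of_endpoint hyx (Or.inl hs), le_dist_of_endpoint hyx (Or.inr ht)⟩
    · exact ⟨le_dist_of_endpoint hyx (Or.inr hs), le_dist_of_endpoint hyx (Or.inl ht)⟩
  refine ⟨y, hmr i₀, ?_⟩
  -- the four segments
  refine ⟨![s i₀, m i₀, s j₀, m j₀], ![m₁, t i₀, m₂, t j₀], ?_, ?_⟩
  · intro n
    fin_cases n
    · exact ⟨hsm₁, Or.inr ⟨(hfar i₀).1, hd₁.le⟩⟩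
    · refine ⟨hmt i₀, Or.inl ⟨?_, (hfar i₀).2⟩⟩
      simp [hy]; exact hηpos.le
    · exact ⟨hsm₂, Or.inr ⟨(hfar j₀).1, hd₂'⟩⟩
    · refine ⟨hmt j₀, Or.inl ⟨?_, (hfar j₀).2⟩⟩
      have : dist (γ (m j₀)) y ≤ η := by rw [dist_comm, hη]; exact hd.le
      simpa using this
  · -- strict separation of the parameter intervals
    have h01 : m₁ < m i₀ := hm₁m
    have h12 : t i₀ < s j₀ := hsep hij
    have h23 : m₂ < m j₀ := hm₂m
    have a1 : m i₀ ≤ t i₀ := hmt i₀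
    have a2 : s j₀ ≤ m₂ := hsm₂
    intro a c hac
    fin_cases a <;> fin_cases c <;> simp at hac ⊢
    · exact h01
    · exact lt_of_lt_of_le (lt_of_le_of_lt (h01.le.trans a1) h12) le_rfl
    · exact lt_of_lt_of_le (lt_of_le_of_lt ((h01.le.trans a1)) h12) (a2.trans h23.le)
    · exact h12
    · exact lt_of_lt_of_le h12 (a2.trans h23.le)
    · exact h23

/-! ### Circle nets and good middle radii -/

/-- **Circle net**: every point of the circle of radius `m` about `x` is within `2πm/k` of one of
the `k` net points `x + m e^{i(-π + 2πj/k)}`, `j < k` (chord ≤ arc). [folklore] -/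
theorem exists_dist_circleNet_le {x y : ℂ} {m : ℝ} (hm : 0 < m) (hy : dist y x = m) {k : ℕ}
    (hk : 1 ≤ k) : ∃ i : ℕ, i < k ∧
      dist y (x + (m : ℂ) * Complex.exp (((-π + 2 * π * i / k : ℝ) : ℂ) * Complex.I)) ≤
        2 * π * m / k := by
  have hkpos : (0 : ℝ) < k := by exact_mod_cast hk
  set θ : ℝ := arg (y - x) with hθ
  have hθ1 : -π < θ := (arg_mem_Ioc (y - x)).1
  have hθ2 : θ ≤ π := (arg_mem_Ioc (y - x)).2
  have hyx : y - x = (m : ℂ) * Complex.exp (θ * Complex.I) := by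
    have h := norm_mul_exp_arg_mul_I (y - x)
    have hn : ‖y - x‖ = m := by rw [← dist_eq_norm]; exact hy
    rw [hn] at h
    exact h.symm
  set t : ℝ := (θ + π) * k / (2 * π) with ht
  have ht0 : 0 ≤ t := div_nonneg (mul_nonneg (by linarith) hkpos.le) (by positivity)
  have htk : t ≤ k := by
    rw [ht, div_le_iff₀ (by positivity)]
    nlinarith [hθ2, Real.pi_pos, hkpos]
  set i : ℕ := min ⌊t⌋₊ (k - 1) with hi
  have hik : i < k := by
    have : i ≤ k - 1 := min_le_right _ _
    omega
  have hti : |t - i| ≤ 1 := by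
    by_cases hle : ⌊t⌋₊ ≤ k - 1
    · have hi' : i = ⌊t⌋₊ := min_eq_left hle
      rw [hi']
      have h1 := Nat.floor_le ht0
      have h2 := Nat.lt_floor_add_one t
      rw [abs_le]
      constructor <;> linarith
    · have hi' : i = k - 1 := min_eq_right (not_le.1 hle).le
      rw [hi']
      have hk' : k ≤ ⌊t⌋₊ := by omega
      have h1 : (k : ℝ) ≤ t := le_trans (by exact_mod_cast hk') (Nat.floor_le ht0)
      have h2 : ((k - 1 : ℕ) : ℝ) = (k : ℝ) - 1 := by
        rw [Nat.cast_sub hk]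
        norm_num
      rw [h2, abs_le]
      constructor <;> linarith
  have hang : |θ - (-π + 2 * π * i / k)| ≤ 2 * π / k := by
    have : θ - (-π + 2 * π * i / k) = 2 * π / k * (t - i) := by
      rw [ht]
      field_simp
      ring
    rw [this, abs_mul, abs_of_pos (by positivity)]
    calc 2 * π / k * |t - i| ≤ 2 * π / k * 1 := by gcongr
      _ = 2 * π / k := mul_one _
  refine ⟨i, hik, ?_⟩
  rw [dist_eq_norm, show y - (x + (m : ℂ) * Complex.exp (((-π + 2 * π * i / k : ℝ) : ℂ) * Complex.I)) =
      (y - x) - (m : ℂ) * Complex.exp (((-π + 2 * π * i / k : ℝ) : ℂ) * Complex.I) by ring, hyx,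
    ← mul_sub, norm_mul, Complex.norm_real, Real.norm_eq_abs, abs_of_pos hm]
  calc m * ‖Complex.exp (θ * Complex.I) - Complex.exp (((-π + 2 * π * i / k : ℝ) : ℂ) * Complex.I)‖
      ≤ m * |θ - (-π + 2 * π * i / k)| := by
        gcongr
        exact norm_exp_mul_I_sub_exp_mul_I_le _ _
    _ ≤ m * (2 * π / k) := by gcongr
    _ = 2 * π * m / k := by ring

/-- If `t` is `w/4`-close to `m`, it is `w/4`-far from any `m'` at distance `≥ w` from `m`. [folklore] -/
theorem far_of_near {t m m' w : ℝ} (h : |t - m| < w / 4) (hm : w ≤ |m' - m|) :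
    w / 4 ≤ |t - m'| := by
  have h1 : |m' - m| ≤ |m' - t| + |t - m| := abs_sub_le m' t m
  rw [abs_sub_comm t m']
  linarith [abs_nonneg (m' - t)]

/-- **Three sub-shells**: for a shell `ρ < R` and two points at distances `t₁, t₂` from the
centre, one of the three middle radii `ρ + w/2, ρ + 3w/2, ρ + 5w/2` (`w = (R−ρ)/3`) is at
distance `≥ w/4 = (R−ρ)/12` from both `t₁` and `t₂` (each `tᵢ` spoils at most one of them). [folklore] -/
theorem exists_good_mid {ρ R : ℝ} (hρR : ρ < R) (t₁ t₂ : ℝ) :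
    ∃ μ : ℝ, ρ + (R - ρ) / 6 ≤ μ ∧ μ + (R - ρ) / 6 ≤ R ∧
      (R - ρ) / 12 ≤ |t₁ - μ| ∧ (R - ρ) / 12 ≤ |t₂ - μ| := by
  set w : ℝ := (R - ρ) / 3 with hw_def
  have hw : 0 < w := by rw [hw_def]; linarith
  have h12 : (R - ρ) / 12 = w / 4 := by rw [hw_def]; ring
  have h6 : (R - ρ) / 6 = w / 2 := by rw [hw_def]; ring
  rw [h12, h6]
  have g10 : w ≤ |(ρ + 3 * w / 2) - (ρ + w / 2)| := by
    rw [show (ρ + 3 * w / 2) - (ρ + w / 2) = w by ring, abs_of_pos hw]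
  have g20 : w ≤ |(ρ + 5 * w / 2) - (ρ + w / 2)| := by
    rw [show (ρ + 5 * w / 2) - (ρ + w / 2) = 2 * w by ring, abs_of_pos (by positivity)]
    linarith
  have g21 : w ≤ |(ρ + 5 * w / 2) - (ρ + 3 * w / 2)| := by
    rw [show (ρ + 5 * w / 2) - (ρ + 3 * w / 2) = w by ring, abs_of_pos hw]
  have hR : R = ρ + 3 * w := by rw [hw_def]; ring
  have b0 : ρ + w / 2 ≤ ρ + w / 2 ∧ ρ + w / 2 + w / 2 ≤ R := ⟨le_rfl, by rw [hR]; linarith⟩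
  have b1 : ρ + w / 2 ≤ ρ + 3 * w / 2 ∧ ρ + 3 * w / 2 + w / 2 ≤ R := ⟨by linarith, by rw [hR]; linarith⟩
  have b2 : ρ + w / 2 ≤ ρ + 5 * w / 2 ∧ ρ + 5 * w / 2 + w / 2 ≤ R := ⟨by linarith, by rw [hR]; linarith⟩
  by_cases h0a : w / 4 ≤ |t₁ - (ρ + w / 2)|
  · by_cases h0b : w / 4 ≤ |t₂ - (ρ + w / 2)|
    · exact ⟨ρ + w / 2, b0.1, b0.2, h0a, h0b⟩
    · have h1b := far_of_near (not_le.1 h0b) g10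
      have h2b := far_of_near (not_le.1 h0b) g20
      by_cases h1a : w / 4 ≤ |t₁ - (ρ + 3 * w / 2)|
      · exact ⟨ρ + 3 * w / 2, b1.1, b1.2, h1a, h1b⟩
      · exact ⟨ρ + 5 * w / 2, b2.1, b2.2, far_of_near (not_le.1 h1a) g21, h2b⟩
  · have h1a := far_of_near (not_le.1 h0a) g10
    have h2a := far_of_near (not_le.1 h0a) g20
    by_cases h1b : w / 4 ≤ |t₂ - (ρ + 3 * w / 2)|
    · exact ⟨ρ + 3 * w / 2, b1.1, b1.2, h1a, h1b⟩
    · exact ⟨ρ + 5 * w / 2, b2.1, b2.2, h2a, far_of_near (not_le.1 h1b) g21⟩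

end Literature.Probability.RandomPlanarGeometry

end
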